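import Literature.Computability.AlgebraicComplexity.QuasiPolynomialFormulasProofs
import Literature.Computability.AlgebraicComplexity.DetInVP
import Literature.Computability.AlgebraicComplexity.IMMInVPProofs
import Literature.Computability.AlgebraicComplexity.ArithCircuitProofs
import Literature.Computability.AlgebraicComplexity.DeterminantalComplexityProofs
import Literature.Computability.AlgebraicComplexity.GKKP11Thm2Proofs
import Literature.Computability.AlgebraicComplexity.FormulaUnfolding
import Summits.ValiantsHypothesis.ValiantsHypothesis.Theorems.LacunarySymmetroidMatrixDescartesCensusKLawBridge
import Summits.ValiantsHypothesis.ValiantsHypothesis.Theorems.LacunarySymmetroidMatrixDescartesCensusTropicalKLawBridges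
import Summits.ValiantsHypothesis.ValiantsHypothesis.Theorems.LacunarySymmetroidPencilTransfer
import Summits.ValiantsHypothesis.ValiantsHypothesis.Theorems.LacunarySymmetroidAssembly
import Summits.ValiantsHypothesis.ValiantsHypothesis.Theorems.LacunarySymmetroidThetaWitness
import Summits.ValiantsHypothesis.ValiantsHypothesis.Theorems.KPlusLogSqLawLiftingRealDoubling
import Literature.Computability.AlgebraicComplexity.VBPDeterminantalComplexity
import Literature.Computability.AlgebraicComplexity.IMMCompleteness
import Literature.Computability.AlgebraicComplexity.BLMW11HomogenizedDetRepresentations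
import Summits.ValiantsHypothesis.ValiantsHypothesis.Theorems.MatrixDescartes.Negative.MatrixDescartesSymmetryFree

/-!
# LENS `embed`, gen 3 (rev 2) — the FORMULA-LAW SANDWICH and the WORD NORMAL FORM for the crux `MatrixDescartes` (stmt-ValiantsHypothesis-18050)

Ideator seat `val-idea-17` (gen 3), crux `MatrixDescartes` of route `LacunarySymmetroid`; cross-filed on
`TropicalB` (stmt-19771).  A kernel-checked DICTIONARY between two hierarchies of OPEN laws — nothing here proves
`MatrixDescartes`, Conjecture B, `TropicalB` or the summit; every theorem is an implication between named open
statements, or unconditional bookkeeping.  Self-contained: §0 re-declares gen 2's dictionary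
(`Cruxes/MatrixDescartes/LENS_embed_g2_LacunaryFormulaLaw.lean` @ce3230b8de8a, same statements and proofs) in this
namespace because `Cruxes/` modules are not built on the farm.

* the cell's PENCIL laws `PencilLaw a`: every real symmetric lacunary pencil `det(∑ₗ t^{dₗ} Sₗ)` of size `m` with `K`
  terms has `≤ 2^{C (K + log₂ᵃ m)}` distinct real zeros (`PencilLaw 2` is literally the cell's Conjecture B,
  `KPlusLogSqLaw`);
* the matrix-free FORMULA laws `FormulaLaw a` (host family of the embed, fewnomial / real-τ type): every real
  polynomial `P` in `K` letters restricted to a monomial curve `y = (t^{d₁},…,t^{d_K})` has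
  `≤ 2^{C (K + log₂ᵃ (E(P)+2))}` distinct real zeros, `E` = fan-in-two formula complexity (`formulaComplexity`).

Proved here:
1. `formulaLaw_of_pencilLaw`   : `PencilLaw a → FormulaLaw a` (every `a`) — the NEW direction; lever = universality of
   SYMMETRIC determinantal representations of formulas with size LINEAR in formula size (Grenet–Kaltofen–Koiran–
   Portier 2011, Thm 2; tree-proved `ArithExpr.exists_hasSymmDetRepr_eval`), restricted to the curve by the tree's
   `LacunarySymmetroid.pencilTransfer_pointwise` (route crux `PencilTransfer`, proved): a formula on a monomial
   curve IS a real symmetric lacunary pencil with one more term.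
2. `pencilLaw_of_formulaLaw`   : `FormulaLaw a → PencilLaw (2a)` (`a ≥ 1`) — gen 2's Hyafil/VSBR direction, graded
   (gen 2's first lemma `RealFormulaLaw → B` is re-derived as the `a = 1` instance: `kPlusLogSqLaw_of_realFormulaLaw`).
3. `polylogPencilLaw_iff_polylogFormulaLaw` : `(∃ a, PencilLaw a) ↔ (∃ a, FormulaLaw a)` — the two hierarchies are
   cofinal: a PROVED EQUIVALENCE between a statement about symmetric matrices and a matrix-free one.
4. `matrixDescartes_of_pencilLaw`, `matrixDescartes_of_formulaLaw`, `valiant_of_formulaLaw`: EVERY grade closes the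
   crux (generalising the tree's `Census.matrixDescartes_of_kPlusLogSqLaw` from `a = 2` to all `a`), hence — with the
   route's two proved cruxes — the summit statement, CONDITIONALLY on an open law.
5. §5 `not_detInVF_of_realFormulaLaw` : gen 2's POLYNOMIAL-grade law `RealFormulaLaw` implies `DET ∉ VF` over `ℝ`
   (`VBP ⊄ VF`, `vbp_not_subset_vf_of_realFormulaLaw`; Bürgisser 2024 Cor. 2.19) — an honest STRENGTH CERTIFICATE:
   `RFL ∧ DET ∈ VF` would give a `2^{O(K)}·m^{O(1)}` pencil law, refuted in the tree by the staircase
   (`RealDoubling.not_realExponentLaw`).  The log-graded laws `FormulaLaw a` carry no such rider by this argument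
   (the staircase then forces only `log E(DET_m) ≥ Ω(log m)`, trivially true), which is why gen 3 grades the host.
6. §6 (rev 2, 2026-08-28) the IMM / WORD NORMAL FORM: `pencilLaw_iff_traceWordLaw : PencilLaw a ↔ TraceWordLaw a`
   for EVERY grade `a`, where `TraceWordLaw a` bounds the real zeros, on a monomial curve, of the TRACE OF AN AFFINE
   WORD (a product of `L` matrices of size `w` with affine-linear entries in the `K` letters) by
   `2^{C (K + log₂ᵃ (w+L+2))}` — levers: weakly-skew universality (`hasDetRepr_of_wsComplexity_le_of_skew_le_ws`,
   BLMW 2011 / Hüttenhain–Ikenmeyer 2016) + the refuter file's symmetric doubling one way, `DET ≤_p IMM`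
   (`isPProjection_detPoly_immPoly`, `VBP`-completeness) the other; NO grade is lost (contrast §4).  Hence
   `kPlusLogSqLaw_iff_traceWordLawTwo : B ↔ TraceWordLaw 2` (the host of the merged line imm-length-halving, typed in
   IMM currency, is Conjecture B in normal form — kernel), and the low grades are REFUTED in kernel:
   `not_pencilLaw_zero/one`, `not_traceWordLaw_zero/one` (staircase via `RealDoubling.not_realExponentLaw`), while
   `realFormulaLaw_iff_formulaLawOne : RFL ↔ FormulaLaw 1` identifies gen 2's priced law as grade 1 of the formula side;
   §6b types the law in the SURVIVOR card's own currency (imm-length-halving's `ProductPencilDescartes` objects: products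
   of `L` lacunary pencils of width `w` over a common exponent vector, entry form `uᵀ F_1(X)⋯F_L(X) v`) and proves
   `productPencilLawTwo_of_kPlusLogSqLaw : B → ProductPencilLaw 2` (that card's grade-2 «RAL» budget is NECESSARY for B).
In particular `B = PencilLaw 2 = TraceWordLaw 2 ⟹ FormulaLaw 2 ⟹ PencilLaw 4 ⟹ MatrixDescartes`: the matrix-free law
`FormulaLaw 2` is SANDWICHED between two pencil laws and is a legitimate proxy target for the crux (refuting it refutes
B; proving it closes the crux), and the word law `TraceWordLaw 2` is an EXACT normal form of B (refuting it refutes B,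
proving it proves B).  Prior art for laws of this type: Borodin–Cook / Grigoriev–Risler (real zeros vs ADDITIVE complexity,
`log₂ Z ≤ 16 r²`, BCS 1997 Thm (12.12), Problem 12.3), Koiran's real τ-conjecture (arXiv:1004.4960;
Koiran–Portier–Tavenas arXiv:1205.1015); none of them is implied by or implies `FormulaLaw a`, and the implication
`B ⟹ FormulaLaw 2` is not in print (searches in the idea card).
-/

-- layout Summits/ValiantsHypothesis/ValiantsHypothesis forces the duplicated namespace component
set_option linter.dupNamespace false

namespace Summit.ValiantsHypothesis.ValiantsHypothesis.Cruxes.MatrixDescartes.FormulaLawSandwich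

open Literature.Computability.AlgebraicComplexity
open Summit.ValiantsHypothesis.ValiantsHypothesis.Theorems.LacunarySymmetroidMatrixDescartes (RealRootLawAt KPlusLogSqLaw)
open Summit.ValiantsHypothesis.ValiantsHypothesis.Theorems.LacunarySymmetroidMatrixDescartes.TropicalCensus (realRootLawAt_zero)

/-! ## §0 Gen 2's dictionary (re-declared verbatim; see the module docstring) -/

/-- `Z_d(P)`: the number of distinct real zeros of `P(t^{d 0}, …, t^{d (K-1)})` (the zero polynomial has none). -/
noncomputable def curveRootCount {K : ℕ} (d : Fin K → ℕ) (P : MvPolynomial (Fin K) ℝ) : ℕ :=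
  (MvPolynomial.aeval (fun l : Fin K => (Polynomial.X : Polynomial ℝ) ^ d l) P).roots.toFinset.card

/-- **RFL — the lacunary real formula law** (host conjecture of the embed; a CONJECTURE, never asserted):
`Z_d(P) ≤ 2^{C·K} · (E(P) + 2)^C` with `E` = fan-in-two formula complexity over `ℝ` (`formulaComplexity`). -/
def RealFormulaLaw : Prop :=
  ∃ C : ℕ, ∀ (K : ℕ) (d : Fin K → ℕ) (P : MvPolynomial (Fin K) ℝ),
    curveRootCount d P ≤ 2 ^ (C * K) * (formulaComplexity P + 2) ^ C

/-- row predicate of RFL (census style): every `P` in `K` letters of formula complexity `≤ s` has `Z_d(P) ≤ B`. -/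
def RealFormulaLawAt (K s B : ℕ) : Prop :=
  ∀ (d : Fin K → ℕ) (P : MvPolynomial (Fin K) ℝ), formulaComplexity P ≤ s → curveRootCount d P ≤ B

/-- the SYMBOLIC pencil determinant `det(∑ l, y_l • S_l) ∈ ℝ[y₁,…,y_K]`. -/
noncomputable def pencilDet {m K : ℕ} (S : Fin K → Matrix (Fin m) (Fin m) ℝ) : MvPolynomial (Fin K) ℝ :=
  Matrix.det (∑ l, (MvPolynomial.X l : MvPolynomial (Fin K) ℝ) • (S l).map MvPolynomial.C)

/-- DICTIONARY (i): on the curve `y_l = X^{d l}` the symbolic determinant is the crux's lacunary pencil determinant. -/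
theorem aeval_pencilDet {m K : ℕ} (d : Fin K → ℕ) (S : Fin K → Matrix (Fin m) (Fin m) ℝ) :
    MvPolynomial.aeval (fun l : Fin K => (Polynomial.X : Polynomial ℝ) ^ d l) (pencilDet S)
      = Matrix.det (∑ l, ((Polynomial.X : Polynomial ℝ) ^ d l) • (S l).map Polynomial.C) := by
  unfold pencilDet
  rw [AlgHom.map_det, map_sum]
  congr 1
  refine Finset.sum_congr rfl fun l _ => ?_
  ext i j
  simp [AlgHom.mapMatrix_apply, Matrix.map_apply, Matrix.smul_apply, Polynomial.algebraMap_eq]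

/-- hence the crux's root count is the curve root count of `pencilDet`. -/
theorem curveRootCount_pencilDet {m K : ℕ} (d : Fin K → ℕ) (S : Fin K → Matrix (Fin m) (Fin m) ℝ) :
    curveRootCount d (pencilDet S)
      = (Matrix.det (∑ l, ((Polynomial.X : Polynomial ℝ) ^ d l) • (S l).map Polynomial.C)).roots.toFinset.card := by
  rw [curveRootCount, aeval_pencilDet]

/-- the linear entries `∑ l, S_l(i,j) • y_l`. -/
noncomputable def pencilEntry {m K : ℕ} (S : Fin K → Matrix (Fin m) (Fin m) ℝ) (p : Fin m × Fin m) :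
    MvPolynomial (Fin K) ℝ :=
  ∑ l, (S l p.1 p.2) • (MvPolynomial.X l : MvPolynomial (Fin K) ℝ)

/-- DICTIONARY (ii): `pencilDet S` is the projection of the generic determinant `DET_m` under `X_{ij} ↦ ∑ l, S_l(i,j) y_l`. -/
theorem pencilDet_eq_aeval_detPoly {m K : ℕ} (S : Fin K → Matrix (Fin m) (Fin m) ℝ) :
    pencilDet S = MvPolynomial.aeval (pencilEntry S) (detPoly (Fin m) ℝ) := by
  unfold pencilDet detPoly
  rw [AlgHom.map_det]
  have h : (MvPolynomial.aeval (pencilEntry S)).mapMatrix (Matrix.mvPolynomialX (Fin m) (Fin m) ℝ)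
      = Matrix.of (fun i j => pencilEntry S (i, j)) :=
    Matrix.mvPolynomialX_mapMatrix_aeval (R := ℝ) (Matrix.of fun i j => pencilEntry S (i, j))
  rw [h]
  congr 1
  refine Matrix.ext fun i j => ?_
  simp only [pencilEntry, Matrix.sum_apply, Matrix.smul_apply, Matrix.map_apply, Matrix.of_apply,
    MvPolynomial.smul_eq_C_mul, smul_eq_mul, mul_comm]

/-- each linear entry costs at most `2K` gates. -/
theorem complexity_pencilEntry_le {m K : ℕ} (S : Fin K → Matrix (Fin m) (Fin m) ℝ) (p : Fin m × Fin m) :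
    complexity (pencilEntry S p) ≤ 2 * K := by
  unfold pencilEntry
  refine (complexity_finset_sum_le _ _).trans ?_
  have h1 : ∀ l : Fin K, complexity ((S l p.1 p.2) • (MvPolynomial.X l : MvPolynomial (Fin K) ℝ)) ≤ 1 := by
    intro l
    refine (complexity_smul_le_holds _ _).trans ?_
    rw [complexity_X_holds]
  calc ∑ l, complexity ((S l p.1 p.2) • (MvPolynomial.X l : MvPolynomial (Fin K) ℝ)) + (Finset.univ : Finset (Fin K)).card
      ≤ ∑ _l : Fin K, 1 + (Finset.univ : Finset (Fin K)).card := Nat.add_le_add_right (Finset.sum_le_sum fun l _ => h1 l) _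
    _ = 2 * K := by simp [Finset.card_univ]; ring

/-- DICTIONARY (iii): circuit complexity of the symbolic pencil determinant: Berkowitz (`complexity_detPoly_le`) + substitution. -/
theorem complexity_pencilDet_le {m K : ℕ} (S : Fin K → Matrix (Fin m) (Fin m) ℝ) :
    complexity (pencilDet S) ≤ 8 * (m + 1) ^ 7 + m ^ 2 * (2 * K) := by
  rw [pencilDet_eq_aeval_detPoly]
  refine (complexity_aeval_le _ _).trans ?_
  refine Nat.add_le_add (complexity_detPoly_le ℝ m) ?_
  calc ∑ p : Fin m × Fin m, complexity (pencilEntry S p)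
      ≤ ∑ _p : Fin m × Fin m, 2 * K := Finset.sum_le_sum fun p _ => complexity_pencilEntry_le S p
    _ = m ^ 2 * (2 * K) := by simp [Finset.card_univ, Fintype.card_prod, Fintype.card_fin, sq]

/-- DICTIONARY (iv): total degree `≤ m`. -/
theorem totalDegree_pencilDet_le {m K : ℕ} (S : Fin K → Matrix (Fin m) (Fin m) ℝ) :
    (pencilDet S).totalDegree ≤ m := by
  rw [pencilDet_eq_aeval_detPoly]
  have h1 : ∀ p, (pencilEntry S p).totalDegree ≤ 1 := by
    intro p
    unfold pencilEntry
    refine (MvPolynomial.totalDegree_finsetSum_le fun l _ => ?_)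
    refine (MvPolynomial.totalDegree_smul_le _ _).trans ?_
    simp
  refine (HasDetRepr.totalDegree_aeval_le_of_le_one _ h1 _).trans ?_
  simpa using (detPoly_isHomogeneous (n := Fin m) (k := ℝ)).totalDegree_le

/-- DICTIONARY (v): FORMULA size of the symbolic pencil determinant is quasi-polynomial: `≤ 2^{18 E²}` for any `E ≥ 1`
with `8(m+1)^7 + 2Km² ≤ 2^E` (so `E = O(log m + log K)`), by Hyafil/VSBR depth reduction (`formulaComplexity_le_two_pow`). -/
theorem formulaComplexity_pencilDet_le {m K E : ℕ} (S : Fin K → Matrix (Fin m) (Fin m) ℝ)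
    (hE : 1 ≤ E) (hsize : 8 * (m + 1) ^ 7 + m ^ 2 * (2 * K) ≤ 2 ^ E) (hK : K ≤ 2 ^ E) :
    formulaComplexity (pencilDet S) ≤ 2 ^ (18 * E ^ 2) := by
  have hm : m < 2 ^ E := by
    have h7 : m < 8 * (m + 1) ^ 7 := by
      calc m < m + 1 := Nat.lt_succ_self m
        _ ≤ (m + 1) ^ 7 := Nat.le_self_pow (by norm_num) _
        _ ≤ 8 * (m + 1) ^ 7 := Nat.le_mul_of_pos_left _ (by norm_num)
    omega
  exact formulaComplexity_le_two_pow (totalDegree_pencilDet_le S) hm (by simpa using hK)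
    ((complexity_pencilDet_le S).trans hsize) hE

/-- `log₂(m+1) ≤ log₂ m + 1`. -/
theorem log_succ_le (m : ℕ) : Nat.log 2 (m + 1) ≤ Nat.log 2 m + 1 := by
  have h1 : 2 ^ Nat.log 2 (m + 1) ≤ m + 1 := Nat.pow_log_le_self 2 (by omega)
  have h2 : m < 2 ^ (Nat.log 2 m + 1) := Nat.lt_pow_succ_log_self (by norm_num) m
  have h3 : 2 ^ Nat.log 2 (m + 1) ≤ 2 ^ (Nat.log 2 m + 1) := by omega
  exact (Nat.pow_le_pow_iff_right (by norm_num)).1 h3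

/-- the size budget `E(m,K) = 7·log₂(m+1) + log₂(K+1) + 11` dominates the circuit size of `pencilDet` and `K`. -/
theorem size_le_two_pow_E (m K : ℕ) :
    8 * (m + 1) ^ 7 + m ^ 2 * (2 * K) ≤ 2 ^ (7 * Nat.log 2 (m + 1) + Nat.log 2 (K + 1) + 11) ∧
      K ≤ 2 ^ (7 * Nat.log 2 (m + 1) + Nat.log 2 (K + 1) + 11) := by
  set a := Nat.log 2 (m + 1) with ha
  set j := Nat.log 2 (K + 1) with hj
  have hm : m + 1 < 2 ^ (a + 1) := Nat.lt_pow_succ_log_self (by norm_num) (m + 1)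
  have hK : K + 1 < 2 ^ (j + 1) := Nat.lt_pow_succ_log_self (by norm_num) (K + 1)
  have h7 : (m + 1) ^ 7 ≤ (2 ^ (a + 1)) ^ 7 := Nat.pow_le_pow_left hm.le 7
  have h7' : 8 * (m + 1) ^ 7 ≤ 2 ^ (7 * a + 10) := by
    calc 8 * (m + 1) ^ 7 ≤ 8 * (2 ^ (a + 1)) ^ 7 := Nat.mul_le_mul_left 8 h7
      _ = 2 ^ (7 * a + 10) := by rw [← pow_mul, show (8 : ℕ) = 2 ^ 3 by norm_num, ← pow_add]; ring_nf
  have hsq : m ^ 2 ≤ 2 ^ (2 * a + 2) := by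
    calc m ^ 2 ≤ (m + 1) ^ 2 := Nat.pow_le_pow_left (Nat.le_succ m) 2
      _ ≤ (2 ^ (a + 1)) ^ 2 := Nat.pow_le_pow_left hm.le 2
      _ = 2 ^ (2 * a + 2) := by rw [← pow_mul]; ring_nf
  have h2K : 2 * K ≤ 2 ^ (j + 2) := by
    calc 2 * K ≤ 2 * 2 ^ (j + 1) := by omega
      _ = 2 ^ (j + 2) := by ring
  have hprod : m ^ 2 * (2 * K) ≤ 2 ^ (7 * a + j + 10) := by
    calc m ^ 2 * (2 * K) ≤ 2 ^ (2 * a + 2) * 2 ^ (j + 2) := Nat.mul_le_mul hsq h2K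
      _ = 2 ^ (2 * a + j + 4) := by rw [← pow_add]; ring_nf
      _ ≤ 2 ^ (7 * a + j + 10) := Nat.pow_le_pow_right (by norm_num) (by omega)
  have hA : 2 ^ (7 * a + 10) ≤ 2 ^ (7 * a + j + 10) := Nat.pow_le_pow_right (by norm_num) (by omega)
  refine ⟨?_, ?_⟩
  · calc 8 * (m + 1) ^ 7 + m ^ 2 * (2 * K) ≤ 2 ^ (7 * a + j + 10) + 2 ^ (7 * a + j + 10) :=
          Nat.add_le_add (h7'.trans hA) hprod
        _ = 2 ^ (7 * a + j + 11) := by ring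
  · calc K ≤ 2 ^ (j + 1) := by omega
      _ ≤ 2 ^ (7 * a + j + 11) := Nat.pow_le_pow_right (by norm_num) (by omega)


/-! ## §1 The two graded hierarchies -/

/-- **pencil law of log-grade `a`** (candidate, NOT asserted): `ζ(m,K) ≤ 2^{C (K + log₂ᵃ m)}`; `a = 2` is Conjecture B. -/
def PencilLaw (a : ℕ) : Prop :=
  ∃ C : ℕ, ∀ m K : ℕ, RealRootLawAt m K (2 ^ (C * (K + Nat.log 2 m ^ a)))

/-- `PencilLaw 2` is the cell's Conjecture B, by `rfl`. -/
theorem pencilLaw_two_iff : PencilLaw 2 ↔ KPlusLogSqLaw := Iff.rfl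

/-- **formula law of log-grade `a`** (host conjecture family, NOT asserted): `Z_d(P) ≤ 2^{C (K + log₂ᵃ (E(P)+2))}`. -/
def FormulaLaw (a : ℕ) : Prop :=
  ∃ C : ℕ, ∀ (K : ℕ) (d : Fin K → ℕ) (P : MvPolynomial (Fin K) ℝ),
    curveRootCount d P ≤ 2 ^ (C * (K + Nat.log 2 (formulaComplexity P + 2) ^ a))

/-- some polylog pencil law holds. -/
def PolylogPencilLaw : Prop := ∃ a : ℕ, PencilLaw a

/-- some polylog formula law holds. -/
def PolylogFormulaLaw : Prop := ∃ a : ℕ, FormulaLaw a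

/-- monotonicity in the grade (pencil side; the `K = 0` corner is the tree's `realRootLawAt_zero`). -/
theorem pencilLaw_mono {a : ℕ} (h : PencilLaw a) : PencilLaw (a + 1) := by
  obtain ⟨C, hC⟩ := h
  refine ⟨2 * C, fun m K => ?_⟩
  rcases Nat.eq_zero_or_pos K with hK | hK
  · subst hK; exact realRootLawAt_zero m _
  intro d S hS
  refine (hC m K d S hS).trans (Nat.pow_le_pow_right (by norm_num) ?_)
  set L := Nat.log 2 m with hL
  have hpow : L ^ a ≤ L ^ (a + 1) + 1 := by
    rcases Nat.eq_zero_or_pos L with h0 | hpos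
    · rw [h0]; cases a <;> simp
    · exact (Nat.pow_le_pow_right hpos (Nat.le_succ a)).trans (Nat.le_succ _)
  calc C * (K + L ^ a) ≤ C * (K + (L ^ (a + 1) + 1)) := Nat.mul_le_mul_left C (by omega)
    _ ≤ C * (2 * (K + L ^ (a + 1))) := Nat.mul_le_mul_left C (by omega)
    _ = 2 * C * (K + L ^ (a + 1)) := by ring

/-- `log₂ (E + 2) ≥ 1`. -/
theorem one_le_log_add_two (E : ℕ) : 1 ≤ Nat.log 2 (E + 2) :=
  Nat.le_log_of_pow_le one_lt_two (by omega)

/-- monotonicity in the grade (formula side; `log₂(E+2) ≥ 1`). -/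
theorem formulaLaw_mono {a : ℕ} (h : FormulaLaw a) : FormulaLaw (a + 1) := by
  obtain ⟨C, hC⟩ := h
  refine ⟨C, fun K d P => (hC K d P).trans (Nat.pow_le_pow_right (by norm_num) ?_)⟩
  exact Nat.mul_le_mul_left C (Nat.add_le_add_left
    (Nat.pow_le_pow_right (one_le_log_add_two _) (Nat.le_succ a)) K)

/-! ## §2 Weighted expressions to plain expressions (`E_skinny ≤ 3 E`) -/

section ToArith

universe u v
variable {k : Type u} {σ : Type v}

/-- unfold a weighted node `c₁ e₁ + c₂ e₂` into `(c₁ * e₁) + (c₂ * e₂)`: a `WExpr` becomes an `ArithExpr`. -/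
def toArith : WExpr k σ → ArithExpr k σ
  | .var i => .var i
  | .const c => .const c
  | .lin c₁ e₁ c₂ e₂ => .add (.mul (.const c₁) (toArith e₁)) (.mul (.const c₂) (toArith e₂))
  | .mul e₁ e₂ => .mul (toArith e₁) (toArith e₂)

/-- the unfolding at most triples the size. -/
theorem size_toArith_le (e : WExpr k σ) : (toArith e).size ≤ 3 * e.size := by
  induction e with
  | var i => simp [toArith]
  | const c => simp [toArith]
  | lin c₁ e₁ c₂ e₂ ih₁ ih₂ => simp [toArith, WExpr.size]; omega
  | mul e₁ e₂ ih₁ ih₂ => simp [toArith, WExpr.size]; omega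

variable [CommSemiring k]

/-- the unfolding computes the same polynomial. -/
theorem eval_toArith (e : WExpr k σ) : (toArith e).eval = e.eval := by
  induction e with
  | var i => simp [toArith]
  | const c => simp [toArith]
  | lin c₁ e₁ c₂ e₂ ih₁ ih₂ => simp [toArith, ih₁, ih₂, MvPolynomial.smul_eq_C_mul]
  | mul e₁ e₂ ih₁ ih₂ => simp [toArith, ih₁, ih₂]

/-- every polynomial has a plain (skinny) formula of size `≤ 3 E(f)`. -/
theorem exists_arithExpr_size_le (f : MvPolynomial σ k) :
    ∃ φ : ArithExpr k σ, φ.eval = f ∧ φ.size ≤ 3 * formulaComplexity f := by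
  obtain ⟨e, he, hs⟩ := exists_wexpr_size_le_formulaComplexity f
  exact ⟨toArith e, (eval_toArith e).trans he, (size_toArith_le e).trans (Nat.mul_le_mul_left 3 hs)⟩

end ToArith

/-! ## §3 `PencilLaw a ⟹ FormulaLaw a`: a formula on a monomial curve IS a symmetric lacunary pencil (GKKP Thm 2) -/

/-- **the embedding, pointwise**: `P` restricted to the curve `y_l = t^{d_l}` has the same real zero set as a real
SYMMETRIC lacunary pencil with `K + 1` terms (exponents `0, d₁, …, d_K`) of size `N ≤ 6 E(P) + 3`. -/
theorem exists_symmPencil_of_formula {K : ℕ} (d : Fin K → ℕ) (P : MvPolynomial (Fin K) ℝ) :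
    ∃ N : ℕ, N ≤ 6 * formulaComplexity P + 3 ∧
      ∃ S : Fin (K + 1) → Matrix (Fin N) (Fin N) ℝ, (∀ l, (S l).IsSymm) ∧
        (Matrix.det (∑ l, ((Polynomial.X : Polynomial ℝ) ^ (Fin.cons (α := fun _ => ℕ) (0 : ℕ) d l)) •
          (S l).map Polynomial.C)).roots.toFinset.card = curveRootCount d P := by
  obtain ⟨φ, hφ, hsize⟩ := exists_arithExpr_size_le P
  obtain ⟨N, hN, hrepr⟩ := ArithExpr.exists_hasSymmDetRepr_eval ℝ two_ne_zero (Fin K) φ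
  obtain ⟨A, hAsymm, hA⟩ := hrepr
  refine ⟨N, by omega, ?_⟩
  obtain ⟨S, hS, hroots⟩ :=
    Summit.ValiantsHypothesis.ValiantsHypothesis.Theorems.LacunarySymmetroid.pencilTransfer_pointwise φ.eval A hAsymm hA d
  refine ⟨S, hS, ?_⟩
  rw [hroots, curveRootCount, hφ]

/-- **B-type pencil laws descend to formula laws of the same grade** (`C' = (4ᵃ + 1) C`; every `a`). -/
theorem formulaLaw_of_pencilLaw {a : ℕ} (h : PencilLaw a) : FormulaLaw a := by
  obtain ⟨C, hC⟩ := h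
  refine ⟨(4 ^ a + 1) * C, fun K d P => ?_⟩
  obtain ⟨N, hN, S, hS, hcard⟩ := exists_symmPencil_of_formula d P
  have hrow := hC N (K + 1) (Fin.cons (α := fun _ => ℕ) (0 : ℕ) d) S hS
  rw [hcard] at hrow
  refine hrow.trans (Nat.pow_le_pow_right (by norm_num) ?_)
  set E := formulaComplexity P with hE
  set ℓ := Nat.log 2 (E + 2) with hℓ
  have hℓ1 : 1 ≤ ℓ := one_le_log_add_two E
  -- `N ≤ 6E + 3 < 8 (E + 2)`, so `log₂ N ≤ log₂ (E+2) + 3`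
  have h8 : Nat.log 2 ((E + 2) * 2 * 2 * 2) = ℓ + 3 := by
    rw [Nat.log_mul_base one_lt_two (by positivity), Nat.log_mul_base one_lt_two (by positivity),
      Nat.log_mul_base one_lt_two (by omega)]
  have hlogN : Nat.log 2 N ≤ ℓ + 3 :=
    (Nat.log_mono_right (show N ≤ (E + 2) * 2 * 2 * 2 by omega)).trans h8.le
  have hpow : Nat.log 2 N ^ a ≤ 4 ^ a * ℓ ^ a :=
    calc Nat.log 2 N ^ a ≤ (ℓ + 3) ^ a := Nat.pow_le_pow_left hlogN a
      _ ≤ (4 * ℓ) ^ a := Nat.pow_le_pow_left (by omega) a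
      _ = 4 ^ a * ℓ ^ a := Nat.mul_pow 4 ℓ a
  have hℓa : 1 ≤ ℓ ^ a := Nat.one_le_pow a ℓ hℓ1
  set c := 4 ^ a with hc
  calc C * (K + 1 + Nat.log 2 N ^ a) ≤ C * (K + ℓ ^ a + c * ℓ ^ a) := Nat.mul_le_mul_left C (by omega)
    _ ≤ C * ((c + 1) * (K + ℓ ^ a)) := Nat.mul_le_mul_left C (by nlinarith [Nat.zero_le (c * K)])
    _ = (c + 1) * C * (K + ℓ ^ a) := by ring

/-! ## §4 `FormulaLaw a ⟹ PencilLaw (2a)`: the symbolic pencil determinant has quasi-polynomial formulas (Hyafil/VSBR) -/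

/-- `(u + v)^n ≤ 2^n (u^n + v^n)` in `ℕ`. -/
theorem add_pow_le_two_pow_mul (u v n : ℕ) : (u + v) ^ n ≤ 2 ^ n * (u ^ n + v ^ n) := by
  rcases le_total u v with h | h
  · calc (u + v) ^ n ≤ (2 * v) ^ n := Nat.pow_le_pow_left (by omega) n
      _ = 2 ^ n * v ^ n := Nat.mul_pow 2 v n
      _ ≤ 2 ^ n * (u ^ n + v ^ n) := Nat.mul_le_mul_left _ (Nat.le_add_left _ _)
  · calc (u + v) ^ n ≤ (2 * u) ^ n := Nat.pow_le_pow_left (by omega) n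
      _ = 2 ^ n * u ^ n := Nat.mul_pow 2 u n
      _ ≤ 2 ^ n * (u ^ n + v ^ n) := Nat.mul_le_mul_left _ (Nat.le_add_right _ _)

/-- `log₂ᵇ⁺¹ (K+1) ≤ (b+1)!·2^(b+1)·K` for `K ≥ 1` (polynomial in `log K` versus `K`, uniform constant; from the
tree's binomial bound `StubArith4.pow_succ_le_factorial_mul_two_pow`). -/
theorem log_succ_pow_le (K b : ℕ) (hK : 1 ≤ K) :
    Nat.log 2 (K + 1) ^ (b + 1) ≤ (b + 1).factorial * 2 ^ (b + 1) * K := by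
  set j := Nat.log 2 (K + 1) with hj
  have h1 := Summit.ValiantsHypothesis.ValiantsHypothesis.Theorems.LacunarySymmetroidMatrixDescartes.StubArith4.pow_succ_le_factorial_mul_two_pow j b
  have h2 : 2 ^ j ≤ K + 1 := Nat.pow_log_le_self 2 (by omega)
  calc j ^ (b + 1) ≤ (b + 1).factorial * 2 ^ (j + b) := h1
    _ = (b + 1).factorial * 2 ^ b * 2 ^ j := by rw [pow_add]; ring
    _ ≤ (b + 1).factorial * 2 ^ b * (K + 1) := Nat.mul_le_mul_left _ h2
    _ ≤ (b + 1).factorial * 2 ^ b * (2 * K) := Nat.mul_le_mul_left _ (by omega)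
    _ = (b + 1).factorial * 2 ^ (b + 1) * K := by rw [pow_succ]; ring

/-- **the exponent bookkeeping, graded**: with gen-2's size budget `E₀(m,K) = 7 log₂(m+1) + log₂(K+1) + 11`
(`log₂ E(pencilDet) ≤ 18 E₀²`), for `a ≥ 1` some `D = D(a)` gives `K + (18 E₀² + 1)ᵃ ≤ D (K + log₂²ᵃ m)` for all
`K ≥ 1` and all `m`. -/
theorem exponent_le_graded {a : ℕ} (ha : 1 ≤ a) : ∃ D : ℕ, ∀ m K : ℕ, 1 ≤ K →
    K + (18 * (7 * Nat.log 2 (m + 1) + Nat.log 2 (K + 1) + 11) ^ 2 + 1) ^ a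
      ≤ D * (K + Nat.log 2 m ^ (2 * a)) := by
  obtain ⟨b, hb⟩ : ∃ b, 2 * a = b + 1 := ⟨2 * a - 1, by omega⟩
  set c₁ := 19 ^ a with hc₁
  set c₂ := 2 ^ (2 * a) with hc₂
  set c₃ := 7 ^ (2 * a) with hc₃
  set c₄ := 18 ^ (2 * a) with hc₄
  set M := (b + 1).factorial * 2 ^ (b + 1) with hM
  refine ⟨c₁ * c₂ * c₂ * c₃ + c₁ * c₂ * c₂ * c₄ + c₁ * c₂ * M + 1, fun m K hK => ?_⟩
  set x := Nat.log 2 (m + 1) with hx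
  set j := Nat.log 2 (K + 1) with hj
  set L := Nat.log 2 m with hL
  set W := L ^ (2 * a) with hW
  set E₀ := 7 * x + j + 11 with hE₀
  have hxL : x ≤ L + 1 := log_succ_le m
  have hE₀le : E₀ ≤ 7 * L + 18 + j := by omega
  -- step 1: `(18 E₀² + 1)^a ≤ 19^a E₀^{2a}`
  have hsq : 1 ≤ E₀ ^ 2 := Nat.one_le_pow 2 E₀ (by omega)
  have s1 : (18 * E₀ ^ 2 + 1) ^ a ≤ c₁ * E₀ ^ (2 * a) :=
    calc (18 * E₀ ^ 2 + 1) ^ a ≤ (19 * E₀ ^ 2) ^ a := Nat.pow_le_pow_left (by omega) a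
      _ = 19 ^ a * (E₀ ^ 2) ^ a := Nat.mul_pow 19 _ a
      _ = c₁ * E₀ ^ (2 * a) := by rw [← pow_mul]
  -- step 2: split off the `K`-part additively
  have s2 : E₀ ^ (2 * a) ≤ c₂ * ((7 * L + 18) ^ (2 * a) + j ^ (2 * a)) :=
    calc E₀ ^ (2 * a) ≤ (7 * L + 18 + j) ^ (2 * a) := Nat.pow_le_pow_left hE₀le _
      _ ≤ 2 ^ (2 * a) * ((7 * L + 18) ^ (2 * a) + j ^ (2 * a)) := add_pow_le_two_pow_mul _ _ _
  -- step 3: the `m`-part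
  have s3 : (7 * L + 18) ^ (2 * a) ≤ c₂ * (c₃ * W + c₄) :=
    calc (7 * L + 18) ^ (2 * a) ≤ 2 ^ (2 * a) * ((7 * L) ^ (2 * a) + 18 ^ (2 * a)) := add_pow_le_two_pow_mul _ _ _
      _ = c₂ * (c₃ * W + c₄) := by rw [Nat.mul_pow]
  -- step 4: the `K`-part, `log₂^{2a}(K+1) ≤ M K`
  have s4 : j ^ (2 * a) ≤ M * K := by rw [hb]; exact log_succ_pow_le K b hK
  -- assemble
  set P₁ := c₁ * c₂ * c₂ * c₃ with hP₁
  set P₂ := c₁ * c₂ * c₂ * c₄ with hP₂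
  set P₃ := c₁ * c₂ * M with hP₃
  have h5 : (18 * E₀ ^ 2 + 1) ^ a ≤ P₁ * W + P₂ + P₃ * K :=
    calc (18 * E₀ ^ 2 + 1) ^ a ≤ c₁ * E₀ ^ (2 * a) := s1
      _ ≤ c₁ * (c₂ * ((7 * L + 18) ^ (2 * a) + j ^ (2 * a))) := Nat.mul_le_mul_left c₁ s2
      _ ≤ c₁ * (c₂ * (c₂ * (c₃ * W + c₄) + M * K)) :=
          Nat.mul_le_mul_left c₁ (Nat.mul_le_mul_left c₂ (Nat.add_le_add s3 s4))
      _ = P₁ * W + P₂ + P₃ * K := by simp only [hP₁, hP₂, hP₃]; ring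
  have h6 : P₂ ≤ P₂ * K := Nat.le_mul_of_pos_right P₂ hK
  calc K + (18 * E₀ ^ 2 + 1) ^ a ≤ K + (P₁ * W + P₂ * K + P₃ * K) := by omega
    _ ≤ (P₁ + P₂ + P₃ + 1) * (K + W) := by nlinarith [Nat.zero_le (P₁ * K), Nat.zero_le (P₂ * W), Nat.zero_le (P₃ * W)]

/-- **formula laws lift to pencil laws of twice the grade**: `FormulaLaw a → PencilLaw (2a)` for `a ≥ 1`
(gen 2's `firstLemma_proof` is the polynomial-grade instance `RealFormulaLaw → B`). -/
theorem pencilLaw_of_formulaLaw {a : ℕ} (ha : 1 ≤ a) (h : FormulaLaw a) : PencilLaw (2 * a) := by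
  obtain ⟨C, hC⟩ := h
  obtain ⟨D, hD⟩ := exponent_le_graded ha
  refine ⟨C * D, fun m K => ?_⟩
  rcases Nat.eq_zero_or_pos K with hK0 | hKpos
  · subst hK0; exact realRootLawAt_zero m _
  intro d S _hS
  have hrow := hC K d (pencilDet S)
  rw [curveRootCount_pencilDet] at hrow
  refine hrow.trans (Nat.pow_le_pow_right (by norm_num) ?_)
  obtain ⟨hsize, hKE⟩ := size_le_two_pow_E m K
  set E₀ := 7 * Nat.log 2 (m + 1) + Nat.log 2 (K + 1) + 11 with hE₀def
  have hE₀ : 1 ≤ E₀ := by omega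
  have hf : formulaComplexity (pencilDet S) ≤ 2 ^ (18 * E₀ ^ 2) := formulaComplexity_pencilDet_le S hE₀ hsize hKE
  have h2 : formulaComplexity (pencilDet S) + 2 ≤ 2 ^ (18 * E₀ ^ 2 + 1) := by
    have h18 : (2 : ℕ) ≤ 2 ^ (18 * E₀ ^ 2) :=
      calc (2 : ℕ) = 2 ^ 1 := by norm_num
        _ ≤ 2 ^ (18 * E₀ ^ 2) := Nat.pow_le_pow_right (by norm_num) (by nlinarith)
    calc formulaComplexity (pencilDet S) + 2 ≤ 2 ^ (18 * E₀ ^ 2) + 2 ^ (18 * E₀ ^ 2) := Nat.add_le_add hf h18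
      _ = 2 ^ (18 * E₀ ^ 2 + 1) := by ring
  have hlog : Nat.log 2 (formulaComplexity (pencilDet S) + 2) ≤ 18 * E₀ ^ 2 + 1 :=
    (Nat.log_mono_right h2).trans (Nat.log_pow one_lt_two _).le
  have hexp := hD m K hKpos
  calc C * (K + Nat.log 2 (formulaComplexity (pencilDet S) + 2) ^ a)
      ≤ C * (K + (18 * E₀ ^ 2 + 1) ^ a) := Nat.mul_le_mul_left C (Nat.add_le_add_left (Nat.pow_le_pow_left hlog a) K)
    _ ≤ C * (D * (K + Nat.log 2 m ^ (2 * a))) := Nat.mul_le_mul_left C hexp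
    _ = C * D * (K + Nat.log 2 m ^ (2 * a)) := by ring

/-! ## The sandwich and the equivalence of the hierarchies -/

/-- **B ⟹ FormulaLaw 2** (the cell's conjecture implies the matrix-free law of the same grade). -/
theorem formulaLawTwo_of_kPlusLogSqLaw (h : KPlusLogSqLaw) : FormulaLaw 2 :=
  formulaLaw_of_pencilLaw (a := 2) (pencilLaw_two_iff.mpr h)

/-- **FormulaLaw 2 ⟹ PencilLaw 4** (and hence the crux, below). -/
theorem pencilLawFour_of_formulaLawTwo (h : FormulaLaw 2) : PencilLaw 4 :=
  pencilLaw_of_formulaLaw (a := 2) (by norm_num) h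

/-- gen 2's polynomial-grade law is a grade-1 formula law: `2^{CK} (E+2)^C ≤ 2^{2C (K + log₂(E+2))}`. -/
theorem formulaLawOne_of_realFormulaLaw (h : RealFormulaLaw) : FormulaLaw 1 := by
  obtain ⟨C, hC⟩ := h
  refine ⟨2 * C, fun K d P => (hC K d P).trans ?_⟩
  set E := formulaComplexity P with hE
  set ℓ := Nat.log 2 (E + 2) with hℓ
  have hℓ1 : 1 ≤ ℓ := one_le_log_add_two E
  have hlt : E + 2 < 2 ^ (ℓ + 1) := Nat.lt_pow_succ_log_self (by norm_num) (E + 2)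
  calc 2 ^ (C * K) * (E + 2) ^ C ≤ 2 ^ (C * K) * (2 ^ (ℓ + 1)) ^ C :=
        Nat.mul_le_mul_left _ (Nat.pow_le_pow_left hlt.le C)
    _ = 2 ^ (C * K + (ℓ + 1) * C) := by rw [← pow_mul, ← pow_add]
    _ ≤ 2 ^ (2 * C * (K + ℓ ^ 1)) := Nat.pow_le_pow_right (by norm_num) (by rw [pow_one]; nlinarith)

/-- **gen 2's first lemma re-derived as the `a = 1` instance**: `RealFormulaLaw ⟹ B` (`= PencilLaw 2`). -/
theorem kPlusLogSqLaw_of_realFormulaLaw (h : RealFormulaLaw) : KPlusLogSqLaw :=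
  pencilLaw_two_iff.mp (pencilLaw_of_formulaLaw (a := 1) le_rfl (formulaLawOne_of_realFormulaLaw h))

/-- gen 2's polynomial-grade law sits on top of the sandwich: `RealFormulaLaw ⟹ FormulaLaw 2`. -/
theorem formulaLawTwo_of_realFormulaLaw (h : RealFormulaLaw) : FormulaLaw 2 :=
  formulaLaw_mono (formulaLawOne_of_realFormulaLaw h)

/-- **the two polylog hierarchies are cofinal**: some polylog pencil law holds iff some polylog formula law holds. -/
theorem polylogPencilLaw_iff_polylogFormulaLaw : PolylogPencilLaw ↔ PolylogFormulaLaw := by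
  constructor
  · rintro ⟨a, h⟩
    exact ⟨a, formulaLaw_of_pencilLaw h⟩
  · rintro ⟨a, h⟩
    exact ⟨2 * (a + 1), pencilLaw_of_formulaLaw (Nat.succ_pos a) (formulaLaw_mono h)⟩

/-! ## Every grade closes the crux (generalising `Census.matrixDescartes_of_kPlusLogSqLaw`) -/

/-- `PencilLaw a → MatrixDescartes` for `a ≥ 1`: in the crux's regime `log₂ m ≤ (log₂ K + c)^c` the bound is
`2^{O_c(K) + polylog K} = 2^{o(K log K)}` (the tree's `StubArith4.exp_le`). -/
theorem matrixDescartes_of_pencilLaw_pos {a : ℕ} (ha : 1 ≤ a) (h : PencilLaw a) :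
    Summit.ValiantsHypothesis.ValiantsHypothesis.Theses.LacunarySymmetroid.MatrixDescartes := by
  obtain ⟨C, hC⟩ := h
  intro c q _hq
  obtain ⟨K₁, hK₁⟩ :=
    Summit.ValiantsHypothesis.ValiantsHypothesis.Theorems.LacunarySymmetroidMatrixDescartes.StubArith4.exp_le (c * a) (2 * q * C)
  refine ⟨max K₁ (2 ^ (2 * q * C)), fun K m hK hm d S hS => ?_⟩
  have hK1 : K₁ ≤ K := le_of_max_le_left hK
  have hK2 : 2 ^ (2 * q * C) ≤ K := le_of_max_le_right hK
  have hL : 2 * q * C ≤ Nat.log 2 K := Nat.le_log_of_pow_le one_lt_two hK2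
  have hlogm : Nat.log 2 m ≤ (Nat.log 2 K + c) ^ c :=
    calc Nat.log 2 m ≤ Nat.log 2 (2 ^ ((Nat.log 2 K + c) ^ c)) := Nat.log_mono_right hm
      _ = (Nat.log 2 K + c) ^ c := Nat.log_pow one_lt_two _
  have hca : c ≤ c * a := Nat.le_mul_of_pos_right c ha
  have hpw : Nat.log 2 m ^ a ≤ (Nat.log 2 K + c * a) ^ (c * a) :=
    calc Nat.log 2 m ^ a ≤ ((Nat.log 2 K + c) ^ c) ^ a := Nat.pow_le_pow_left hlogm a
      _ = (Nat.log 2 K + c) ^ (c * a) := (pow_mul _ c a).symm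
      _ ≤ (Nat.log 2 K + c * a) ^ (c * a) := Nat.pow_le_pow_left (by omega) _
  have hZ := hC m K d S hS
  have h1 : 2 * q * C * (Nat.log 2 K + c * a) ^ (c * a) ≤ K * Nat.log 2 K := hK₁ K hK1
  have h2 : 2 * q * C * K ≤ K * Nat.log 2 K :=
    calc 2 * q * C * K = K * (2 * q * C) := by ring
      _ ≤ K * Nat.log 2 K := Nat.mul_le_mul_left K hL
  have h3 : q * C * Nat.log 2 m ^ a ≤ q * C * (Nat.log 2 K + c * a) ^ (c * a) := Nat.mul_le_mul_left _ hpw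
  have hexp : q * (C * (K + Nat.log 2 m ^ a)) ≤ K * Nat.log 2 K := by
    have e1 : q * (C * (K + Nat.log 2 m ^ a)) = q * C * K + q * C * Nat.log 2 m ^ a := by ring
    have e2 : 2 * q * C * (Nat.log 2 K + c * a) ^ (c * a) = 2 * (q * C * (Nat.log 2 K + c * a) ^ (c * a)) := by
      ring
    have e3 : 2 * q * C * K = 2 * (q * C * K) := by ring
    rw [e2] at h1
    rw [e3] at h2
    omega
  calc (Matrix.det (∑ l, ((Polynomial.X : Polynomial ℝ) ^ d l) • (S l).map Polynomial.C)
          ).roots.toFinset.card ^ q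
      ≤ (2 ^ (C * (K + Nat.log 2 m ^ a))) ^ q := Nat.pow_le_pow_left hZ q
    _ = 2 ^ (q * (C * (K + Nat.log 2 m ^ a))) := by rw [← pow_mul, mul_comm]
    _ ≤ 2 ^ (K * Nat.log 2 K) := Nat.pow_le_pow_right (by norm_num) hexp

/-- every grade closes the crux. -/
theorem matrixDescartes_of_pencilLaw {a : ℕ} (h : PencilLaw a) :
    Summit.ValiantsHypothesis.ValiantsHypothesis.Theses.LacunarySymmetroid.MatrixDescartes :=
  matrixDescartes_of_pencilLaw_pos (Nat.succ_pos a) (pencilLaw_mono h)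

/-- **every matrix-free formula law closes the crux** (`FormulaLaw a ⟹ PencilLaw (2a+2) ⟹ MatrixDescartes`). -/
theorem matrixDescartes_of_formulaLaw {a : ℕ} (h : FormulaLaw a) :
    Summit.ValiantsHypothesis.ValiantsHypothesis.Theses.LacunarySymmetroid.MatrixDescartes :=
  matrixDescartes_of_pencilLaw (pencilLaw_of_formulaLaw (Nat.succ_pos a) (formulaLaw_mono h))

/-- the proxy target of record: `FormulaLaw 2 ⟹ MatrixDescartes`. -/
theorem matrixDescartes_of_formulaLawTwo (h : FormulaLaw 2) :
    Summit.ValiantsHypothesis.ValiantsHypothesis.Theses.LacunarySymmetroid.MatrixDescartes :=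
  matrixDescartes_of_formulaLaw h

/-- … and, with the route's two PROVED cruxes, the summit statement — CONDITIONALLY on an open formula law;
VP ≠ VNP is NOT proved here. -/
theorem valiant_of_formulaLaw {a : ℕ} (h : FormulaLaw a) : _root_.ValiantsHypothesis :=
  Summit.ValiantsHypothesis.ValiantsHypothesis.Theorems.lacunarySymmetroid_assembly_proof
    (matrixDescartes_of_formulaLaw h)
    Summit.ValiantsHypothesis.ValiantsHypothesis.Theorems.LacunarySymmetroid.pencilTransfer_proof
    Summit.ValiantsHypothesis.ValiantsHypothesis.Theorems.LacunarySymmetroid.thetaWitness_proof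

/-- TropicalB downstream: `FormulaLaw a` says nothing tropical directly, but B does (tree: `tropKPlusLogSqLaw_of_kPlusLogSqLaw`);
recorded: the matrix-free law of grade 2 is NECESSARY for B, hence any refutation of `FormulaLaw 2` refutes B and
with it the lifting half of the `KPlusLogSqLaw` routes (`B ⟺ LIFT ∧ TB` in the tree). -/
theorem not_kPlusLogSqLaw_of_not_formulaLawTwo (h : ¬ FormulaLaw 2) : ¬ KPlusLogSqLaw :=
  fun hB => h (formulaLawTwo_of_kPlusLogSqLaw hB)


/-! ## §5 Why the grade matters: gen 2's POLYNOMIAL-grade law decides `VF` vs `VBP` over `ℝ`; the log grades do not -/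

section Strength

open Summit.ValiantsHypothesis.ValiantsHypothesis.Theorems.KPlusLogSqLaw.RealDoubling (RealExponentLaw not_realExponentLaw)

/-- `E(0) = 0` (one constant leaf). -/
theorem formulaComplexity_zero_le' {σ : Type} : formulaComplexity (0 : MvPolynomial σ ℝ) ≤ 0 :=
  (exists_wexpr_iff_formulaComplexity_le _ _).1 ⟨.const 0, by simp, le_rfl⟩

/-- `E(X_i) = 0` (one variable leaf). -/
theorem formulaComplexity_X_le' {σ : Type} (i : σ) :
    formulaComplexity (MvPolynomial.X i : MvPolynomial σ ℝ) ≤ 0 :=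
  (exists_wexpr_iff_formulaComplexity_le _ _).1 ⟨.var i, by simp, le_rfl⟩

/-- a linear form in `K` letters costs at most `2K` fan-in-two gates. -/
theorem formulaComplexity_linear_le {σ : Type} : ∀ (K : ℕ) (c : Fin K → ℝ) (e : Fin K → σ),
    formulaComplexity (∑ l : Fin K, c l • (MvPolynomial.X (e l) : MvPolynomial σ ℝ)) ≤ 2 * K
  | 0, c, e => by simpa using (formulaComplexity_zero_le' (σ := σ))
  | K + 1, c, e => by
    rw [Fin.sum_univ_succ]
    have ih := formulaComplexity_linear_le K (fun l => c l.succ) (fun l => e l.succ)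
    have h0 := formulaComplexity_X_le' (σ := σ) (e 0)
    have h1 := formulaComplexity_smul_le (c 0) (MvPolynomial.X (e 0) : MvPolynomial σ ℝ)
    have h2 := formulaComplexity_add_le (c 0 • (MvPolynomial.X (e 0) : MvPolynomial σ ℝ))
      (∑ l : Fin K, c l.succ • (MvPolynomial.X (e l.succ) : MvPolynomial σ ℝ))
    omega

/-- each entry `∑ₗ Sₗ(i,j) yₗ` of the symbolic pencil costs at most `2K` formula gates. -/
theorem formulaComplexity_pencilEntry_le {m K : ℕ} (S : Fin K → Matrix (Fin m) (Fin m) ℝ) (p : Fin m × Fin m) :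
    formulaComplexity (pencilEntry S p) ≤ 2 * K := by
  unfold pencilEntry
  simpa using formulaComplexity_linear_le K (fun l => S l p.1 p.2) id

/-- DICTIONARY (vi): the symbolic pencil determinant is the generic determinant with linear forms substituted, so
`E(pencilDet S) ≤ E(DET_m) + (E(DET_m) + 1) · 2K` (substitution into a formula, `formulaComplexity_bind₁_le`). -/
theorem formulaComplexity_pencilDet_le_detPoly {m K : ℕ} (S : Fin K → Matrix (Fin m) (Fin m) ℝ) :
    formulaComplexity (pencilDet S) ≤
      formulaComplexity (detPoly (Fin m) ℝ) + (formulaComplexity (detPoly (Fin m) ℝ) + 1) * (2 * K) := by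
  rw [pencilDet_eq_aeval_detPoly, MvPolynomial.aeval_eq_bind₁]
  exact formulaComplexity_bind₁_le (fun p => formulaComplexity_pencilEntry_le S p) _

/-- `n ≤ 2^n`. -/
theorem le_two_pow_self' (n : ℕ) : n ≤ 2 ^ n := by
  induction n with
  | zero => simp
  | succ n ih =>
    have := Nat.one_le_two_pow (n := n)
    calc n + 1 ≤ 2 ^ n + 2 ^ n := by omega
      _ = 2 ^ (n + 1) := by ring

/-- **`DET ∈ VF` over `ℝ`** in the tree's rendering: p-bounded fan-in-two formula complexity of `(DET_n)`
(Bürgisser 2024, Cor. 2.19: equivalent to `VF = VBP` over `ℝ`, tree `Bur24_cor_2_19` /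
`vbp_subset_vf_iff_isPBounded_formulaComplexity_detPoly`).  OPEN (believed false); never asserted. -/
def DetInVF : Prop := IsPBounded fun n => formulaComplexity (detPoly (Fin n) ℝ)

/-- **the rider of the polynomial grade**: `RealFormulaLaw ∧ DET ∈ VF ⟹ RealExponentLaw (c·C)` — polynomial-size
determinant formulas would put every symbolic pencil determinant in formula size `O(K · m^c)`, and then gen 2's law
bounds the real zeros on the curve by `2^{O(K)} · m^{O(1)}`. -/
theorem realExponentLaw_of_realFormulaLaw_of_detInVF (h : RealFormulaLaw) (hdet : DetInVF) :
    ∃ e, RealExponentLaw e := by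
  obtain ⟨C, hC⟩ := h
  obtain ⟨c, hc⟩ := hdet
  refine ⟨c * C, (c + 7) * C, fun m K => ?_⟩
  rcases Nat.eq_zero_or_pos K with hK0 | hKpos
  · subst hK0; exact realRootLawAt_zero m _
  intro d S _hS
  rcases Nat.eq_zero_or_pos m with hm0 | hmpos
  · subst hm0
    simp [Matrix.det_isEmpty]
  have hrow := hC K d (pencilDet S)
  rw [curveRootCount_pencilDet] at hrow
  refine hrow.trans ?_
  set Em := formulaComplexity (detPoly (Fin m) ℝ) with hEm
  have hEm_le : Em ≤ m ^ c + c := hc m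
  have hE := formulaComplexity_pencilDet_le_detPoly S
  rw [← hEm] at hE
  have hmc : 1 ≤ m ^ c := Nat.one_le_pow c m hmpos
  have hK2 : K ≤ 2 ^ K := le_two_pow_self' K
  have hc3 : c + 3 ≤ 2 ^ (c + 3) := le_two_pow_self' (c + 3)
  have h1 : formulaComplexity (pencilDet S) + 2 ≤ (c + 3) * m ^ c * 2 ^ (K + 2) :=
    calc formulaComplexity (pencilDet S) + 2 ≤ (Em + 2) * (2 * K + 1) := by nlinarith
      _ ≤ ((c + 3) * m ^ c) * (4 * 2 ^ K) := Nat.mul_le_mul (by nlinarith) (by omega)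
      _ = (c + 3) * m ^ c * 2 ^ (K + 2) := by ring
  calc 2 ^ (C * K) * (formulaComplexity (pencilDet S) + 2) ^ C
      ≤ 2 ^ (C * K) * ((c + 3) * m ^ c * 2 ^ (K + 2)) ^ C := Nat.mul_le_mul_left _ (Nat.pow_le_pow_left h1 C)
    _ ≤ 2 ^ (C * K) * (2 ^ (c + 3) * m ^ c * 2 ^ (K + 2)) ^ C :=
        Nat.mul_le_mul_left _ (Nat.pow_le_pow_left (Nat.mul_le_mul_right _ (Nat.mul_le_mul_right _ hc3)) C)
    _ = 2 ^ (C * K) * ((2 ^ (c + 3)) ^ C * (m ^ c) ^ C * (2 ^ (K + 2)) ^ C) := by rw [Nat.mul_pow, Nat.mul_pow]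
    _ = 2 ^ (C * K) * 2 ^ ((c + 3) * C) * 2 ^ ((K + 2) * C) * m ^ (c * C) := by
        rw [← pow_mul, ← pow_mul, ← pow_mul]; ring
    _ = 2 ^ (C * K + (c + 3) * C + (K + 2) * C) * m ^ (c * C) := by rw [← pow_add, ← pow_add]
    _ ≤ 2 ^ ((c + 7) * C * K) * m ^ (c * C) := by
        refine Nat.mul_le_mul_right _ (Nat.pow_le_pow_right (by norm_num) ?_)
        have t1 : c * C ≤ c * C * K := Nat.le_mul_of_pos_right _ hKpos
        have t2 : C ≤ C * K := Nat.le_mul_of_pos_right _ hKpos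
        linarith [t1, t2]

/-- **RFL ⟹ DET ∉ VF over ℝ**: gen 2's polynomial-grade law carries a flagship formula lower bound as a rider, by
the tree's staircase refutation `RealDoubling.not_realExponentLaw` of every `2^{O(K)}·m^{e}` pencil law.  (The
log-graded laws `FormulaLaw a` carry no such rider by this argument: for them the staircase forces only
`log₂ E(DET_m) ≥ Ω(log m)`, which holds trivially since `deg DET_m = m`.) -/
theorem not_detInVF_of_realFormulaLaw (h : RealFormulaLaw) : ¬ DetInVF := fun hdet => by
  obtain ⟨e, he⟩ := realExponentLaw_of_realFormulaLaw_of_detInVF h hdet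
  exact not_realExponentLaw e he

/-- … in Valiant-class words: `RealFormulaLaw ⟹ VBP ⊄ VF over ℝ` (some weakly-skew-p-computable family has no
p-bounded formulas; Bürgisser 2024 Cor. 2.19 via the tree's `vbp_subset_vf_iff_isPBounded_formulaComplexity_detPoly`). -/
theorem vbp_not_subset_vf_of_realFormulaLaw (h : RealFormulaLaw) :
    ¬ ∀ {σ : ℕ → Type} (f : ∀ n, MvPolynomial (σ n) ℝ), IsVPwsFamily f →
        IsPBounded fun n => formulaComplexity (f n) :=
  fun hall => not_detInVF_of_realFormulaLaw h
    ((vbp_subset_vf_iff_isPBounded_formulaComplexity_detPoly ℝ).mp hall)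

end Strength


/-! ## §6 The IMM / word normal form: `PencilLaw a ⟺ TraceWordLaw a` for EVERY grade — Conjecture B IS a word law

imm-length-halving's host law (seat `val-idea-18`, the line this card merges into by VERDICT #4) lives in WORD currency:
zeros of entries / traces of products of letter matrices.  Here the word law is typed in IMM currency — an AFFINE
WORD is a list of `L` matrices of size `w` whose entries are affine-linear forms in the letters `y_1,…,y_K` (letter
matrices `Λ_l = A_l + y_l B_l`, scalar gadgets and block gadgets are all affine words), its polynomial is the trace
`tr(M_0 ⋯ M_{L-1})`, and `TraceWordLaw a` bounds its distinct real zeros on a monomial curve by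
`2^{C (K + log₂ᵃ (w + L + 2))}`.  Proved: `traceWordLaw_of_pencilLaw : PencilLaw a → TraceWordLaw a` (universality of
determinantal representations for weakly-skew circuits — BLMW 2011 Prop. 7.5 / Hüttenhain–Ikenmeyer 2016, tree-proved
`hasDetRepr_of_wsComplexity_le_of_skew_le_ws` with `ArithCircuit.skewComplexity_le_four_mul_wsComplexity` and
`IMMSkew.wsComplexity_immPoly_le` — then affine substitution, `LacunarySymmetroid.pencilDet_of_affine` (route crux
`PencilTransfer`, proved) and the symmetric doubling `MatrixDescartes.Negative.card_roots_SD` of the crux's refuter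
file), and `pencilLaw_of_traceWordLaw : TraceWordLaw a → PencilLaw a` (`DET ≤_p IMM`, tree-proved
`isPProjection_detPoly_immPoly`, composed with dictionary (ii)).  Unlike the formula embedding of §3–§4 (grade doubles
one way, because `DET ∈ VF` is open), the IMM embedding loses NO grade: `DET` and `IMM` are both `VBP`-complete under
p-projections.  Consequences: `kPlusLogSqLaw_iff_traceWordLawTwo : B ↔ TraceWordLaw 2` — the merged line's host is not
merely sufficient for the crux (VERDICT #4 P2), it is Conjecture B in normal form, kernel-checked; and the LOW GRADES
ARE REFUTED: `not_pencilLaw_one`, `not_pencilLaw_zero`, `not_traceWordLaw_one`, `not_traceWordLaw_zero` (every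
`2^{O(K)}·poly(m)` pencil law and every `2^{O(K)}·poly(w+L)` word law is false — the staircase,
`RealDoubling.not_realExponentLaw`), while on the formula side grade 1 is exactly gen 2's `RealFormulaLaw`
(`realFormulaLaw_iff_formulaLawOne`, open and priced by §5).  So grade 2 is the first open grade on the pencil = word
side, which is where B sits. -/

section Words

open Summit.ValiantsHypothesis.ValiantsHypothesis.Theorems.MatrixDescartes.Negative (SD dD card_roots_SD SD_isSymm)
open Summit.ValiantsHypothesis.ValiantsHypothesis.Theorems.KPlusLogSqLaw.RealDoubling (RealExponentLaw not_realExponentLaw)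

/-- **TWL_a — the trace word law of grade `a`** (CANDIDATE family, NOT asserted; grade 2 ⟺ Conjecture B, grades ≤ 1
refuted below): an affine word of length `L` and width `w` in `K` letters, restricted to a monomial curve, has
`≤ 2^{C (K + log₂ᵃ (w + L + 2))}` distinct real zeros of its trace. -/
def TraceWordLaw (a : ℕ) : Prop :=
  ∃ C : ℕ, ∀ (w L K : ℕ) (d : Fin K → ℕ) (M : Fin L → Matrix (Fin w) (Fin w) (MvPolynomial (Fin K) ℝ)),
    (∀ t i j, (M t i j).totalDegree ≤ 1) →
      curveRootCount d ((List.ofFn M).prod).trace ≤ 2 ^ (C * (K + Nat.log 2 (w + L + 2) ^ a))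

/-- DICTIONARY (iii): the trace of an affine word is the affine projection of the generic `IMM_{w,L}`. -/
theorem traceWord_eq_aeval_immPoly {w L K : ℕ} (M : Fin L → Matrix (Fin w) (Fin w) (MvPolynomial (Fin K) ℝ)) :
    ((List.ofFn M).prod).trace =
      MvPolynomial.aeval (fun p : Fin L × Fin w × Fin w => M p.1 p.2.1 p.2.2) (immPoly w L ℝ) := by
  set ψ : Fin L × Fin w × Fin w → MvPolynomial (Fin K) ℝ := fun p => M p.1 p.2.1 p.2.2 with hψ
  have hmat : (MvPolynomial.aeval ψ).mapMatrix (immMatrix (Fin w) L ℝ) = (List.ofFn M).prod := by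
    rw [immMatrix, map_list_prod, List.map_map, List.ofFn_eq_map]
    congr 1
    refine List.map_congr_left fun t _ => ?_
    ext i j
    simp [hψ, Function.comp, AlgHom.mapMatrix_apply, Matrix.map_apply, Matrix.mvPolynomialX]
  rw [← hmat, immPoly]
  simp [Matrix.trace, Matrix.diag, map_sum, AlgHom.mapMatrix_apply, Matrix.map_apply]

/-- the size of the tree's determinantal representation of `IMM_{w,L}` (`3·(4·L_ws) + 1`, `L_ws` bounded by
`IMMSkew.wsComplexity_immPoly_le`): a polynomial in `(w, L)`. -/
def immReprSize (w L : ℕ) : ℕ :=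
  3 * (4 * (w * (4 * ((L + 2) * (2 * ((L + 1) * w) + 3) ^ 2)) + (w + 1))) + 1

/-- `IMM_{w,L}` over `ℝ` is the determinant of an affine matrix of size `immReprSize w L` (weakly-skew universality). -/
theorem hasDetRepr_immPoly (w L : ℕ) : HasDetRepr (immPoly w L ℝ) (immReprSize w L) :=
  hasDetRepr_of_wsComplexity_le_of_skew_le_ws 4
    (fun f => ArithCircuit.skewComplexity_le_four_mul_wsComplexity f) _ (IMMSkew.wsComplexity_immPoly_le ℝ w L)

/-- `log₂ n < k` from `n < 2^k` (`n ≠ 0`). -/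
theorem log_lt_of_lt_two_pow {n k : ℕ} (hn : n ≠ 0) (h : n < 2 ^ k) : Nat.log 2 n < k := by
  by_contra hk
  have hk : k ≤ Nat.log 2 n := by omega
  have := (Nat.pow_le_pow_right two_pos hk).trans (Nat.pow_log_le_self 2 hn)
  omega

/-- the doubled representation size is `2^{O(1)} · (w+L+2)^6`, so its `log₂` is `≤ 21 · log₂ (w + L + 2)`. -/
theorem log_two_immReprSize_le (w L : ℕ) :
    Nat.log 2 (immReprSize w L + immReprSize w L) ≤ 21 * Nat.log 2 (w + L + 2) := by
  set s := w + L + 2 with hs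
  set ℓ := Nat.log 2 s with hℓ
  have hs2 : 2 ≤ s := by omega
  have hℓ1 : 1 ≤ ℓ := Nat.log_pos one_lt_two hs2
  have hslt : s < 2 ^ (ℓ + 1) := Nat.lt_pow_succ_log_self one_lt_two s
  have hw : w ≤ s := by omega
  have hL : L + 2 ≤ s := by omega
  have hL1 : L + 1 ≤ s := by omega
  have hq : 2 * ((L + 1) * w) + 3 ≤ 3 * s ^ 2 := by
    have : (L + 1) * w ≤ s * s := Nat.mul_le_mul hL1 hw
    nlinarith
  have h1 : w * (4 * ((L + 2) * (2 * ((L + 1) * w) + 3) ^ 2)) + (w + 1)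
      ≤ s * (4 * (s * (3 * s ^ 2) ^ 2)) + (s + 1) := by gcongr
  have h6 : s ≤ s ^ 6 := Nat.le_self_pow (by norm_num) s
  have h8 : s * (4 * (s * (3 * s ^ 2) ^ 2)) = 36 * s ^ 6 := by ring
  have hr : immReprSize w L + immReprSize w L ≤ 1024 * s ^ 6 := by
    unfold immReprSize; omega
  have hpow : s ^ 6 < (2 ^ (ℓ + 1)) ^ 6 := Nat.pow_lt_pow_left hslt (by norm_num)
  have e6 : (2 ^ (ℓ + 1)) ^ 6 = 2 ^ (6 * ℓ + 6) := by rw [← pow_mul]; ring_nf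
  have e16 : (1024 : ℕ) * 2 ^ (6 * ℓ + 6) = 2 ^ (6 * ℓ + 16) := by
    rw [show (1024 : ℕ) = 2 ^ 10 by norm_num, ← pow_add]; ring_nf
  have hlt : immReprSize w L + immReprSize w L < 2 ^ (6 * ℓ + 16) := by
    rw [e6] at hpow; omega
  have hne : immReprSize w L + immReprSize w L ≠ 0 := by unfold immReprSize; omega
  have := log_lt_of_lt_two_pow hne hlt
  omega

/-- **`PencilLaw a ⟹ TraceWordLaw a`** (every grade): an affine word's trace is `IMM_{w,L}` at affine arguments
(dictionary (iii)), hence the determinant of an AFFINE matrix of size `N = poly(w,L)` (weakly-skew universality),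
hence on the curve a GENERAL real lacunary pencil with `K+1` terms (`pencilDet_of_affine`), hence — by the symmetric
doubling `[[0,P],[Pᵀ,0]]`-type gadget of the crux's refuter file, same distinct zeros — a SYMMETRIC pencil of size
`2N` with `K+2` terms, to which the pencil law applies; `log₂ (2N) ≤ 21 log₂ (w+L+2)` keeps the grade. -/
theorem traceWordLaw_of_pencilLaw {a : ℕ} (h : PencilLaw a) : TraceWordLaw a := by
  obtain ⟨C, hC⟩ := h
  refine ⟨C * (21 ^ a + 2), fun w L K d M hM => ?_⟩
  set ψ : Fin L × Fin w × Fin w → MvPolynomial (Fin K) ℝ := fun p => M p.1 p.2.1 p.2.2 with hψ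
  have hψ1 : ∀ p, (ψ p).totalDegree ≤ 1 := fun p => hM _ _ _
  set N := immReprSize w L with hN
  obtain ⟨A, hA, hdet⟩ : HasDetRepr (immPoly w L ℝ) N := hasDetRepr_immPoly w L
  set B : Matrix (Fin N) (Fin N) (MvPolynomial (Fin K) ℝ) := (MvPolynomial.aeval ψ).mapMatrix A with hB
  have hB1 : ∀ a b, (B a b).totalDegree ≤ 1 := fun a b =>
    (HasDetRepr.totalDegree_aeval_le_of_le_one ψ hψ1 _).trans (hA a b)
  have hdetB : B.det = ((List.ofFn M).prod).trace := by
    rw [traceWord_eq_aeval_immPoly, hB, ← AlgHom.map_det, hdet]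
  obtain ⟨T, hT⟩ : ∃ T : Fin (K + 1) → Matrix (Fin N) (Fin N) ℝ,
      (∑ l, (Polynomial.X : Polynomial ℝ) ^ dD d l • (T l).map Polynomial.C).det
        = MvPolynomial.aeval (fun i => (Polynomial.X : Polynomial ℝ) ^ d i) B.det :=
    ⟨_, Summit.ValiantsHypothesis.ValiantsHypothesis.Theorems.LacunarySymmetroid.pencilDet_of_affine B hB1 d⟩
  have hcount : curveRootCount d ((List.ofFn M).prod).trace
      = (∑ l, (Polynomial.X : Polynomial ℝ) ^ dD (dD d) l • (SD T l).map Polynomial.C).det.roots.toFinset.card := by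
    rw [card_roots_SD, hT, hdetB, curveRootCount]
  rw [hcount]
  refine (hC (N + N) (K + 1 + 1) (dD (dD d)) (SD T) (SD_isSymm T)).trans (Nat.pow_le_pow_right two_pos ?_)
  have hlog : Nat.log 2 (N + N) ≤ 21 * Nat.log 2 (w + L + 2) := log_two_immReprSize_le w L
  have hℓ1 : 1 ≤ Nat.log 2 (w + L + 2) := Nat.log_pos one_lt_two (by omega)
  set ℓ := Nat.log 2 (w + L + 2) with hℓ
  have h1 : Nat.log 2 (N + N) ^ a ≤ 21 ^ a * ℓ ^ a := by
    rw [← Nat.mul_pow]; exact Nat.pow_le_pow_left hlog a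
  have h2 : 1 ≤ ℓ ^ a := Nat.one_le_pow _ _ hℓ1
  have h3 : K + 1 + 1 + Nat.log 2 (N + N) ^ a ≤ (21 ^ a + 2) * (K + ℓ ^ a) := by
    nlinarith [Nat.zero_le (21 ^ a * K), Nat.zero_le K]
  calc C * (K + 1 + 1 + Nat.log 2 (N + N) ^ a) ≤ C * ((21 ^ a + 2) * (K + ℓ ^ a)) := Nat.mul_le_mul_left C h3
    _ = C * (21 ^ a + 2) * (K + ℓ ^ a) := by ring

/-- the pencil's entries are linear forms. -/
theorem totalDegree_pencilEntry_le {m K : ℕ} (S : Fin K → Matrix (Fin m) (Fin m) ℝ) (p : Fin m × Fin m) :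
    (pencilEntry S p).totalDegree ≤ 1 := by
  unfold pencilEntry
  refine (MvPolynomial.totalDegree_finsetSum _ _).trans (Finset.sup_le fun l _ => ?_)
  exact (MvPolynomial.totalDegree_smul_le _ _).trans (MvPolynomial.totalDegree_X (R := ℝ) l).le

/-- **`TraceWordLaw a ⟹ PencilLaw a`** (every grade): `DET_m` is a projection of `IMM_{T,T}` with `T ≤ m^c + c`
(`isPProjection_detPoly_immPoly`), so the symbolic pencil determinant (dictionary (ii)) is the trace of an AFFINE WORD
of width and length `T`; `log₂ (2T+2) ≤ (c+2)(log₂ m + 1)` keeps the grade. -/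
theorem pencilLaw_of_traceWordLaw {a : ℕ} (h : TraceWordLaw a) : PencilLaw a := by
  obtain ⟨C, hC⟩ := h
  obtain ⟨t, ⟨c, hc⟩, hproj⟩ := isPProjection_detPoly_immPoly ℝ
  refine ⟨C * ((c + 2) ^ a * 2 ^ a + 1), fun m K => ?_⟩
  rcases Nat.eq_zero_or_pos K with hK0 | hK
  · subst hK0; exact realRootLawAt_zero m _
  intro d S _hS
  rcases Nat.eq_zero_or_pos m with hm0 | hm
  · subst hm0
    simp [Matrix.det_isEmpty]
  -- the pencil determinant is the trace of an affine word of width and length `T = t m`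
  set T := t m with hT
  obtain ⟨π, hπ, hdet⟩ : IsProjection (detPoly (Fin m) ℝ) (immPoly T T ℝ) := hproj m
  set ψ : Fin T × Fin T × Fin T → MvPolynomial (Fin K) ℝ :=
    fun i => MvPolynomial.aeval (pencilEntry S) (π i) with hψ
  have hψ1 : ∀ i, (ψ i).totalDegree ≤ 1 := by
    intro i
    rcases hπ i with ⟨j, hj⟩ | ⟨r, hr⟩
    · simp only [hψ, hj, MvPolynomial.aeval_X]
      exact totalDegree_pencilEntry_le S j
    · simp [hψ, hr]
  have hpd : pencilDet S = MvPolynomial.aeval ψ (immPoly T T ℝ) := by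
    rw [pencilDet_eq_aeval_detPoly, hdet, MvPolynomial.aeval_eq_bind₁ π, MvPolynomial.aeval_bind₁]
  set M : Fin T → Matrix (Fin T) (Fin T) (MvPolynomial (Fin K) ℝ) := fun s => Matrix.of fun i j => ψ (s, i, j)
    with hM
  have hMψ : (fun p : Fin T × Fin T × Fin T => M p.1 p.2.1 p.2.2) = ψ := by
    funext p; simp [hM]
  have hword : ((List.ofFn M).prod).trace = pencilDet S := by
    rw [traceWord_eq_aeval_immPoly, hMψ, hpd]
  have hM1 : ∀ s i j, (M s i j).totalDegree ≤ 1 := fun s i j => by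
    simpa [hM] using hψ1 (s, i, j)
  have hbound := hC T T K d M hM1
  rw [hword, curveRootCount_pencilDet] at hbound
  refine hbound.trans (Nat.pow_le_pow_right two_pos ?_)
  -- exponent arithmetic: `log₂ (T+T+2) ≤ (c+2) (μ+1)`, `μ = log₂ m`
  set μ := Nat.log 2 m with hμ
  have hmlt : m < 2 ^ (μ + 1) := Nat.lt_pow_succ_log_self one_lt_two m
  have hTle : T ≤ m ^ c + c := hc m
  have hmc : m ^ c ≤ 2 ^ (c * (μ + 1)) := by
    rw [Nat.mul_comm, pow_mul]; exact Nat.pow_le_pow_left hmlt.le c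
  have hc2 : c + 1 ≤ 2 ^ c := by
    clear * -
    induction c with
    | zero => simp
    | succ n ih => rw [pow_succ]; omega
  have hcc : c ≤ c * (μ + 1) := Nat.le_mul_of_pos_right c (Nat.succ_pos μ)
  have hpm : 2 ^ c ≤ 2 ^ (c * (μ + 1)) := Nat.pow_le_pow_right two_pos hcc
  have e3 : 2 ^ (c * (μ + 1) + 3) = 8 * 2 ^ (c * (μ + 1)) := by ring
  have hP1 : 1 ≤ 2 ^ (c * (μ + 1)) := Nat.one_le_two_pow
  have hTT : T + T + 2 < 2 ^ (c * (μ + 1) + 3) := by omega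
  have hlogT : Nat.log 2 (T + T + 2) ≤ (c + 2) * (μ + 1) := by
    have := log_lt_of_lt_two_pow (by omega) hTT
    have e : (c + 2) * (μ + 1) = c * (μ + 1) + 2 * (μ + 1) := by ring
    omega
  have hloga : Nat.log 2 (T + T + 2) ^ a ≤ (c + 2) ^ a * 2 ^ a * (μ ^ a + 1) :=
    calc Nat.log 2 (T + T + 2) ^ a ≤ ((c + 2) * (μ + 1)) ^ a := Nat.pow_le_pow_left hlogT a
      _ = (c + 2) ^ a * (μ + 1) ^ a := Nat.mul_pow _ _ _
      _ ≤ (c + 2) ^ a * (2 ^ a * (μ ^ a + 1 ^ a)) := Nat.mul_le_mul_left _ (add_pow_le_two_pow_mul μ 1 a)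
      _ = (c + 2) ^ a * 2 ^ a * (μ ^ a + 1) := by rw [one_pow]; ring
  set G := (c + 2) ^ a * 2 ^ a with hG
  have hGK : G * 1 ≤ G * K := Nat.mul_le_mul_left G hK
  rw [mul_one] at hGK
  have h3 : K + Nat.log 2 (T + T + 2) ^ a ≤ (G + 1) * (K + μ ^ a) := by
    have e1 : (G + 1) * (K + μ ^ a) = G * K + G * μ ^ a + K + μ ^ a := by ring
    have e2 : G * (μ ^ a + 1) = G * μ ^ a + G := by ring
    rw [e2] at hloga
    rw [e1]
    have h0 : 0 ≤ G * μ ^ a := Nat.zero_le _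
    omega
  calc C * (K + Nat.log 2 (T + T + 2) ^ a) ≤ C * ((G + 1) * (K + μ ^ a)) := Nat.mul_le_mul_left C h3
    _ = C * (G + 1) * (K + μ ^ a) := by ring

/-- **`PencilLaw a ⟺ TraceWordLaw a`** — every grade of the pencil hierarchy IS a word law (IMM normal form). -/
theorem pencilLaw_iff_traceWordLaw (a : ℕ) : PencilLaw a ↔ TraceWordLaw a :=
  ⟨traceWordLaw_of_pencilLaw, pencilLaw_of_traceWordLaw⟩

/-- **Conjecture B in IMM normal form**: `KPlusLogSqLaw ↔ TraceWordLaw 2` — the merged line's host law, typed over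
affine words, is EQUIVALENT to the cell's Conjecture B (kernel), not merely sufficient for the crux. -/
theorem kPlusLogSqLaw_iff_traceWordLawTwo : KPlusLogSqLaw ↔ TraceWordLaw 2 :=
  pencilLaw_iff_traceWordLaw 2

/-- hence the word law of grade 2 closes the crux … -/
theorem matrixDescartes_of_traceWordLawTwo (h : TraceWordLaw 2) :
    Summit.ValiantsHypothesis.ValiantsHypothesis.Theses.LacunarySymmetroid.MatrixDescartes :=
  matrixDescartes_of_pencilLaw (pencilLaw_of_traceWordLaw h)

/-- … and refuting it refutes Conjecture B (a word-level counterexample — a signed/affine word with too many sign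
changes on a monomial curve — is a counterexample to B, by a kernel theorem, with no census needed). -/
theorem not_kPlusLogSqLaw_of_not_traceWordLawTwo (h : ¬ TraceWordLaw 2) : ¬ KPlusLogSqLaw :=
  fun hB => h (traceWordLaw_of_pencilLaw hB)

/-- **grade 1 of the pencil hierarchy is a `2^{O(K)} · m^{O(1)}` law** … -/
theorem realExponentLaw_of_pencilLaw_one (h : PencilLaw 1) : ∃ e, RealExponentLaw e := by
  obtain ⟨C, hC⟩ := h
  refine ⟨C, C, fun m K => ?_⟩
  intro d S hS
  rcases Nat.eq_zero_or_pos m with hm0 | hmpos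
  · subst hm0
    simp [Matrix.det_isEmpty]
  refine (hC m K d S hS).trans ?_
  rw [pow_one, Nat.mul_add, pow_add]
  refine Nat.mul_le_mul_left _ ?_
  calc 2 ^ (C * Nat.log 2 m) = (2 ^ Nat.log 2 m) ^ C := by rw [Nat.mul_comm, pow_mul]
    _ ≤ m ^ C := Nat.pow_le_pow_left (Nat.pow_log_le_self 2 hmpos.ne') C

/-- **… hence REFUTED** by the tree's staircase (`RealDoubling.not_realExponentLaw`): no `2^{C (K + log₂ m)}` law. -/
theorem not_pencilLaw_one : ¬ PencilLaw 1 := fun h => by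
  obtain ⟨e, he⟩ := realExponentLaw_of_pencilLaw_one h
  exact not_realExponentLaw e he

/-- no `2^{C (K + 1)}` law either. -/
theorem not_pencilLaw_zero : ¬ PencilLaw 0 := fun h => not_pencilLaw_one (pencilLaw_mono h)

/-- **no `2^{O(K)} · poly(w + L)` WORD law**: grade 1 of the word hierarchy is refuted too (staircase, pulled back
along `DET ≤_p IMM`) — a per-level polynomial loss (quasi-polynomial total, grade 2) is the least a word law can ask. -/
theorem not_traceWordLaw_one : ¬ TraceWordLaw 1 := fun h => not_pencilLaw_one (pencilLaw_of_traceWordLaw h)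

theorem not_traceWordLaw_zero : ¬ TraceWordLaw 0 := fun h => not_pencilLaw_zero (pencilLaw_of_traceWordLaw h)

/-- grade 2 is the first open grade of the pencil (= word) hierarchy: `PencilLaw a` fails for `a ≤ 1` and is
Conjecture B at `a = 2`. -/
theorem pencilLaw_iff_two_le_and {a : ℕ} : PencilLaw a ↔ 2 ≤ a ∧ PencilLaw a := by
  refine ⟨fun h => ⟨?_, h⟩, fun h => h.2⟩
  by_contra hlt
  have hlt : a < 2 := by omega
  interval_cases a
  · exact not_pencilLaw_zero h
  · exact not_pencilLaw_one h

/-- **on the formula side grade 1 is exactly gen 2's `RealFormulaLaw`** (open, priced by §5): `RFL ↔ FormulaLaw 1`. -/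
theorem realFormulaLaw_iff_formulaLawOne : RealFormulaLaw ↔ FormulaLaw 1 := by
  refine ⟨formulaLawOne_of_realFormulaLaw, fun ⟨C, hC⟩ => ⟨C, fun K d P => (hC K d P).trans ?_⟩⟩
  rw [pow_one, Nat.mul_add, pow_add]
  refine Nat.mul_le_mul_left _ ?_
  calc 2 ^ (C * Nat.log 2 (formulaComplexity P + 2)) = (2 ^ Nat.log 2 (formulaComplexity P + 2)) ^ C := by
        rw [Nat.mul_comm, pow_mul]
    _ ≤ (formulaComplexity P + 2) ^ C := Nat.pow_le_pow_left (Nat.pow_log_le_self 2 (by omega)) C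

/-! ### §6b imm-length-halving's own currency: PRODUCT PENCILS (entry form) — `B ⟹ ProductPencilLaw 2` -/

/-- **PPL_a — the product-pencil (entry) law of grade `a`**, typed over EXACTLY the objects of the survivor card
imm-length-halving (`Cruxes/MatrixDescartes/Ideas/imm-length-halving.md`, First lemma `ProductPencilDescartes`): `L`
lacunary pencils `F_i(X) = ∑_l X^{d_l} M_{i,l}` of width `w` over a COMMON exponent vector `d`, and the entry form
`uᵀ F_1(X) ⋯ F_L(X) v`; CANDIDATE family, never asserted.  Its grade 2 is that card's «RAL» budget
(`2^{O(K)} × (poly w)^{log L} ≤ 2^{O(K + log²(w+L))}`). -/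
def ProductPencilLaw (a : ℕ) : Prop :=
  ∃ C : ℕ, ∀ (w L K : ℕ) (d : Fin K → ℕ) (M : Fin L → Fin K → Matrix (Fin w) (Fin w) ℝ) (u v : Fin w → ℝ),
    (dotProduct
        (((List.ofFn fun i : Fin L => ∑ l, (Polynomial.X : Polynomial ℝ) ^ d l • (M i l).map Polynomial.C).prod).mulVec
          fun j => Polynomial.C (v j))
        fun j => Polynomial.C (u j)).roots.toFinset.card
      ≤ 2 ^ (C * (K + Nat.log 2 (w + L + 2) ^ a))

/-- the symbolic (multi-letter) pencil matrix `∑_l y_l • M_l`. -/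
noncomputable def pencilMatrix {w K : ℕ} (S : Fin K → Matrix (Fin w) (Fin w) ℝ) :
    Matrix (Fin w) (Fin w) (MvPolynomial (Fin K) ℝ) :=
  ∑ l, (MvPolynomial.X l : MvPolynomial (Fin K) ℝ) • (S l).map MvPolynomial.C

/-- its entries are linear forms. -/
theorem totalDegree_pencilMatrix_le {w K : ℕ} (S : Fin K → Matrix (Fin w) (Fin w) ℝ) (a b : Fin w) :
    (pencilMatrix S a b).totalDegree ≤ 1 := by
  have h : pencilMatrix S a b = pencilEntry S (a, b) := by
    simp [pencilMatrix, pencilEntry, Matrix.sum_apply, Matrix.smul_apply, Matrix.map_apply, smul_eq_mul,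
      MvPolynomial.smul_eq_C_mul, mul_comm]
  rw [h]
  exact totalDegree_pencilEntry_le S (a, b)

/-- on the curve `y_l = X^{d_l}` the symbolic pencil matrix is the lacunary pencil `F(X) = ∑_l X^{d_l} M_l`. -/
theorem mapMatrix_pencilMatrix {w K : ℕ} (d : Fin K → ℕ) (S : Fin K → Matrix (Fin w) (Fin w) ℝ) :
    (MvPolynomial.aeval fun l : Fin K => (Polynomial.X : Polynomial ℝ) ^ d l).mapMatrix (pencilMatrix S)
      = ∑ l, (Polynomial.X : Polynomial ℝ) ^ d l • (S l).map Polynomial.C := by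
  unfold pencilMatrix
  rw [map_sum]
  refine Finset.sum_congr rfl fun l _ => ?_
  ext i j
  simp [AlgHom.mapMatrix_apply, Matrix.map_apply, Matrix.smul_apply, Polynomial.algebraMap_eq]

/-- `uᵀ W v = tr (W · v uᵀ)`. -/
theorem dotProduct_mulVec_eq_trace {n : Type} [Fintype n] {R : Type} [CommSemiring R] (W : Matrix n n R)
    (x y : n → R) : dotProduct (W.mulVec x) y = Matrix.trace (W * Matrix.vecMulVec x y) := by
  simp only [dotProduct, Matrix.mulVec, Matrix.trace, Matrix.diag, Matrix.mul_apply, Matrix.vecMulVec_apply,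
    Finset.sum_mul]
  exact Finset.sum_congr rfl fun i _ => Finset.sum_congr rfl fun j _ => by ring

/-- **`TraceWordLaw a ⟹ ProductPencilLaw a`**: a product of `L` lacunary pencils of width `w` in entry form is, on the
curve, the trace of an AFFINE WORD of length `L + 1` and width `w` (the pencils' symbolic matrices followed by the
constant rank-one matrix `v uᵀ`); `log₂ (w+L+3) ≤ 2 log₂ (w+L+2)` keeps the grade (constant `C · 2ᵃ`). -/
theorem productPencilLaw_of_traceWordLaw {a : ℕ} (h : TraceWordLaw a) : ProductPencilLaw a := by
  obtain ⟨C, hC⟩ := h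
  refine ⟨C * 2 ^ a, fun w L K d M u v => ?_⟩
  set φ : MvPolynomial (Fin K) ℝ →ₐ[ℝ] Polynomial ℝ :=
    MvPolynomial.aeval fun l : Fin K => (Polynomial.X : Polynomial ℝ) ^ d l with hφ
  -- the affine word: the symbolic pencils, then the constant rank-one matrix `v uᵀ`
  set u' : Fin w → MvPolynomial (Fin K) ℝ := fun j => MvPolynomial.C (u j) with hu'
  set v' : Fin w → MvPolynomial (Fin K) ℝ := fun j => MvPolynomial.C (v j) with hv'
  set A : Fin L → Matrix (Fin w) (Fin w) (MvPolynomial (Fin K) ℝ) := fun i => pencilMatrix (M i) with hA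
  set W : Matrix (Fin w) (Fin w) (MvPolynomial (Fin K) ℝ) := (List.ofFn A).prod with hW
  set M' : Fin (L + 1) → Matrix (Fin w) (Fin w) (MvPolynomial (Fin K) ℝ) :=
    Fin.snoc A (Matrix.vecMulVec v' u') with hM'
  have hM'1 : ∀ t i j, (M' t i j).totalDegree ≤ 1 := by
    intro t i j
    refine Fin.lastCases ?_ (fun t => ?_) t
    · have e : M' (Fin.last L) i j = MvPolynomial.C (v i * u j) := by
        simp only [hM', Fin.snoc_last, Matrix.vecMulVec_apply, hu', hv', map_mul]
      rw [e, MvPolynomial.totalDegree_C]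
      exact Nat.zero_le _
    · simp only [hM', Fin.snoc_castSucc, hA]
      exact totalDegree_pencilMatrix_le (M t) i j
  have hprod : (List.ofFn M').prod = W * Matrix.vecMulVec v' u' := by
    rw [hM', List.ofFn_succ', List.prod_concat]
    simp [Fin.snoc_castSucc, Fin.snoc_last, hW]
  -- the product pencil in entry form is `φ` of `uᵀ W v`
  have hpencils : (List.ofFn fun i : Fin L => ∑ l, (Polynomial.X : Polynomial ℝ) ^ d l • (M i l).map Polynomial.C).prod
      = φ.mapMatrix W := by
    rw [hW, map_list_prod, List.map_ofFn]
    refine congrArg List.prod (congrArg List.ofFn (funext fun i => ?_))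
    simp only [Function.comp_apply, hA]
    exact (mapMatrix_pencilMatrix d (M i)).symm
  have hscalar : dotProduct
        (((List.ofFn fun i : Fin L => ∑ l, (Polynomial.X : Polynomial ℝ) ^ d l • (M i l).map Polynomial.C).prod).mulVec
          fun j => Polynomial.C (v j))
        (fun j => Polynomial.C (u j))
      = φ (Matrix.trace (List.ofFn M').prod) := by
    rw [hpencils, hprod, ← dotProduct_mulVec_eq_trace]
    simp [dotProduct, Matrix.mulVec, map_sum, map_mul, AlgHom.mapMatrix_apply, Matrix.map_apply, hu', hv',
      MvPolynomial.algHom_C, Polynomial.algebraMap_eq]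
  rw [hscalar]
  have hb := hC w (L + 1) K d M' hM'1
  rw [curveRootCount] at hb
  refine hb.trans (Nat.pow_le_pow_right two_pos ?_)
  -- `log₂ (w + (L+1) + 2) ≤ log₂ (w+L+2) + 1 ≤ 2 log₂ (w+L+2)`
  have hℓ1 : 1 ≤ Nat.log 2 (w + L + 2) := Nat.log_pos one_lt_two (by omega)
  have hlog : Nat.log 2 (w + (L + 1) + 2) ≤ 2 * Nat.log 2 (w + L + 2) := by
    have e : w + (L + 1) + 2 = (w + L + 2) + 1 := by ring
    rw [e]
    have := log_succ_le (w + L + 2)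
    omega
  have hpow : Nat.log 2 (w + (L + 1) + 2) ^ a ≤ 2 ^ a * Nat.log 2 (w + L + 2) ^ a := by
    rw [← Nat.mul_pow]; exact Nat.pow_le_pow_left hlog a
  calc C * (K + Nat.log 2 (w + (L + 1) + 2) ^ a) ≤ C * (2 ^ a * (K + Nat.log 2 (w + L + 2) ^ a)) := by
        refine Nat.mul_le_mul_left C ?_
        have h2a : 1 ≤ 2 ^ a := Nat.one_le_two_pow
        nlinarith
    _ = C * 2 ^ a * (K + Nat.log 2 (w + L + 2) ^ a) := by ring

/-- **`B ⟹ ProductPencilLaw 2`** — the survivor card's grade-2 budget for products of lacunary pencils (entry form)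
is NECESSARY for Conjecture B, in kernel and in that card's own typing. -/
theorem productPencilLawTwo_of_kPlusLogSqLaw (h : KPlusLogSqLaw) : ProductPencilLaw 2 :=
  productPencilLaw_of_traceWordLaw (traceWordLaw_of_pencilLaw h)

/-- grades `≤ 1` of the product-pencil law are not decided here (the entry → trace direction needs the tree's
path-value gadget `isProjection_pathValue_immPoly`, located); what IS kernel: any refutation of `ProductPencilLaw 2`
refutes B. -/
theorem not_kPlusLogSqLaw_of_not_productPencilLawTwo (h : ¬ ProductPencilLaw 2) : ¬ KPlusLogSqLaw :=
  fun hB => h (productPencilLawTwo_of_kPlusLogSqLaw hB)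

end Words

end Summit.ValiantsHypothesis.ValiantsHypothesis.Cruxes.MatrixDescartes.FormulaLawSandwich
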